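import Summits.AtomisticToContinuum.FouriersLaw.Theorems.LatticeLandauDampingAbelThermodynamicLimitFixedFrequencyMatchingAutocorrBound
import HarnessLib

/-!
# `stub_fixedFrequencyMatching` of line `series-law-at-every-laplace-frequency`, part 3:
pair-correlation sums, windows with a general anchor, and the boundary rows
(crux `LatticeLandauDamping.AbelThermodynamicLimit`, item stmt-AtomisticToContinuum-14013, `Iff.rfl`-identical
to `EmbeddedDrudeMourre.AbelThermodynamicLimit`, stmt-AtomisticToContinuum-12596; `--supports` helper file
proving the registered helper stub `stub_totalCurrentAutocorrEqSumPairCorr`, closes nothing)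

Part 2 reduced the registered stub S3 `stub_fixedFrequencyMatching` to the FIXED-TIME bond-averaged
matching `c_N(t)/N → C_T(t)` (`t > 0`) of the open chain's total-current autocorrelation
`c_N(t) = ∫ J · (P_t J) dμ_{N,T}`, `J = Σ_i j_i`. Part 4 reduces that, in turn, to ANCHOR-UNIFORM versions
of the two dynamical leaves of the sibling line `loomis-compact-horizon-witness` (anchored correlation
tails = light cone at fixed time; per-offset fixed-time matching = two-dynamics coupling + ensemble
equivalence). This file (sorry-free) supplies the fixed-`N` ingredients, with the equilibrium pair
correlations `K_N(i,k,t) = ⟨j_i(0) j_k(t)⟩_{N,T} = ∫ j_i · (P_t j_k) dμ_{N,T}`: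

* §1 window bookkeeping around a GENERAL anchor `i` (the sibling's §3 is anchored at the central bond):
  reindexing the window `|k - i| ≤ R` by offsets, `≤ 2R + 1` bonds in a window, `≤ 2L` anchors within
  distance `L` of the ends, tail monotonicity in `R`;
* §2 `c_N(t) = Σ_i Σ_k K_N(i,k,t)` (registered helper stub `stub_totalCurrentAutocorrEqSumPairCorr`) and
  the row sums `Σ_k K_N(i,k,t) = ∫ j_i · (P_t J) dμ_{N,T}`;
* §3 the WEIGHTED pairing bound `|∫ f · P_u g dμ_T| ≤ ½(λ‖f‖² + λ⁻¹‖g‖²)` (`λ > 0`; AM–GM + the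
  `L²(μ_T)`-contraction) and its consequence `|Σ_k K_N(i,k,t)| ≤ ½(λM + λ⁻¹·3MN)` for EVERY anchor — the
  `o(N)` control of the `O(1)` boundary rows in the bond average (optimising `λ ~ √N` gives `O(√N)`).

References: Bonetto–Lebowitz–Rey-Bellet 2000 §7; Kundu–Dhar–Narayan 2009. No named fact is used.
-/

noncomputable section

open MeasureTheory ProbabilityTheory Filter Topology Set Function
open scoped NNReal ENNReal

namespace Summit.AtomisticToContinuum.FouriersLaw.Theorems.AbelThermodynamicLimit.SeriesLawAtEveryLaplaceFrequency

open Literature.MathematicalPhysics.KineticTheory.HeatConduction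
open Literature.MathematicalPhysics.KineticTheory OscillatorChain
open Summit.AtomisticToContinuum.FouriersLaw.Theorems.SubdiffusiveBondHeat
open Summit.AtomisticToContinuum.FouriersLaw.Theorems.LightConeBondHeat
open Summit.AtomisticToContinuum.FouriersLaw.Theorems.OddSectorIrreversibility
open Summit.AtomisticToContinuum.FouriersLaw.Theorems.OddSectorIrreversibility.Corrector
open Summit.AtomisticToContinuum.FouriersLaw.Theorems.AbelThermodynamicLimit.LoomisCompactHorizonWitness

variable {N : ℕ}

/-! ## §1 Windows around a general anchor

The window of radius `R` around the anchor `i` is `{k : i - R ≤ k ≤ i + R}`, written subtraction-free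
as `i ≤ k + R ∧ k ≤ i + R`; the anchor is `L`-deep in the bulk when `L ≤ i` and `i + L < N`. -/

/-- **Reindexing a bulk window by offsets**: for an anchor `i` with `R ≤ i`, `i + R < N`, summing
`c(k - i)` over the window `|k - i| ≤ R` is summing `c(x)` over the offsets `x ∈ [-R, R]`. [folklore] -/
theorem sum_ite_window_offset_eq_sum_Icc {R : ℕ} {i : Fin N} (hiR : R ≤ i.val) (hiN : i.val + R < N)
    (c : ℤ → ℝ) :
    (∑ k : Fin N, if i.val ≤ k.val + R ∧ k.val ≤ i.val + R then c ((k.val : ℤ) - i.val) else 0) =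
      ∑ x ∈ Finset.Icc (-(R : ℤ)) R, c x := by
  rw [← Finset.sum_filter]
  refine Finset.sum_bij' (fun k _ => (k.val : ℤ) - i.val)
    (fun x hx => ⟨((i.val : ℤ) + x).toNat, ?_⟩) ?_ ?_ ?_ ?_ ?_
  · simp only [Finset.mem_Icc] at hx
    omega
  · intro k hk
    simp only [Finset.mem_filter, Finset.mem_univ, true_and] at hk
    simp only [Finset.mem_Icc]
    omega
  · intro x hx
    simp only [Finset.mem_Icc] at hx
    simp only [Finset.mem_filter, Finset.mem_univ, true_and]
    omega
  · intro k hk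
    ext
    simp only
    omega
  · intro x hx
    simp only [Finset.mem_Icc] at hx
    simp only
    omega
  · intro k hk
    rfl

/-- A window of radius `R` contains at most `2R + 1` bonds. [folklore] -/
theorem card_window_le (R : ℕ) (i : Fin N) :
    (Finset.univ.filter fun k : Fin N => i.val ≤ k.val + R ∧ k.val ≤ i.val + R).card ≤ 2 * R + 1 := by
  calc (Finset.univ.filter fun k : Fin N => i.val ≤ k.val + R ∧ k.val ≤ i.val + R).card
      ≤ (Finset.Icc (i.val - R) (i.val + R)).card :=
        Finset.card_le_card_of_injOn (fun k => k.val) (fun k hk => by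
          simp only [Finset.coe_filter, Finset.mem_univ, true_and, Set.mem_setOf_eq] at hk
          simp only [Finset.coe_Icc, Set.mem_Icc]
          omega) Fin.val_injective.injOn
    _ = i.val + R + 1 - (i.val - R) := Nat.card_Icc _ _
    _ ≤ 2 * R + 1 := by omega

/-- `Σ_{window} a ≤ (2R + 1)·a` for `a ≥ 0`. [folklore] -/
theorem sum_ite_window_const_le' (R : ℕ) (i : Fin N) {a : ℝ} (ha : 0 ≤ a) :
    (∑ k : Fin N, if i.val ≤ k.val + R ∧ k.val ≤ i.val + R then a else 0) ≤ (2 * R + 1) * a := by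
  rw [← Finset.sum_filter, Finset.sum_const, nsmul_eq_mul]
  have h : ((Finset.univ.filter fun k : Fin N => i.val ≤ k.val + R ∧ k.val ≤ i.val + R).card : ℝ) ≤
      2 * R + 1 := by exact_mod_cast card_window_le R i
  exact mul_le_mul_of_nonneg_right h ha

/-- At most `2L` anchors are within distance `L` of the two ends of the chain. [folklore] -/
theorem card_not_bulk_le (N L : ℕ) :
    (Finset.univ.filter fun i : Fin N => ¬(L ≤ i.val ∧ i.val + L < N)).card ≤ 2 * L := by
  calc (Finset.univ.filter fun i : Fin N => ¬(L ≤ i.val ∧ i.val + L < N)).card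
      ≤ (Finset.range L ∪ Finset.Ico (N - L) N).card :=
        Finset.card_le_card_of_injOn (fun i => i.val) (fun i hi => by
          simp only [Finset.coe_filter, Finset.mem_univ, true_and, Set.mem_setOf_eq] at hi
          simp only [Finset.coe_union, Finset.coe_range, Finset.coe_Ico, Set.mem_union, Set.mem_Iio,
            Set.mem_Ico]
          omega) Fin.val_injective.injOn
    _ ≤ (Finset.range L).card + (Finset.Ico (N - L) N).card := Finset.card_union_le _ _
    _ ≤ 2 * L := by rw [Finset.card_range, Nat.card_Ico]; omega

/-- `Σ_{non-bulk anchors} a ≤ 2L·a` for `a ≥ 0`. [folklore] -/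
theorem sum_ite_not_bulk_const_le (N L : ℕ) {a : ℝ} (ha : 0 ≤ a) :
    (∑ i : Fin N, if L ≤ i.val ∧ i.val + L < N then 0 else a) ≤ 2 * L * a := by
  have e : (∑ i : Fin N, if L ≤ i.val ∧ i.val + L < N then 0 else a) =
      ∑ i : Fin N, if ¬(L ≤ i.val ∧ i.val + L < N) then a else 0 :=
    Finset.sum_congr rfl fun i _ => by split_ifs <;> simp_all
  rw [e, ← Finset.sum_filter, Finset.sum_const, nsmul_eq_mul]
  have h : ((Finset.univ.filter fun i : Fin N => ¬(L ≤ i.val ∧ i.val + L < N)).card : ℝ) ≤ 2 * L := by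
    exact_mod_cast card_not_bulk_le N L
  exact mul_le_mul_of_nonneg_right h ha

/-- Tail monotonicity: the sum of `|g|` outside the window of radius `R'` is at most the sum outside
the window of radius `R ≤ R'`. [folklore] -/
theorem tail_antitone' (i : Fin N) {R R' : ℕ} (h : R ≤ R') (g : Fin N → ℝ) :
    (∑ k : Fin N, if i.val ≤ k.val + R' ∧ k.val ≤ i.val + R' then (0 : ℝ) else |g k|) ≤
      ∑ k : Fin N, if i.val ≤ k.val + R ∧ k.val ≤ i.val + R then (0 : ℝ) else |g k| := by
  refine Finset.sum_le_sum fun k _ => ?_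
  by_cases h1 : i.val ≤ k.val + R ∧ k.val ≤ i.val + R
  · have h2 : i.val ≤ k.val + R' ∧ k.val ≤ i.val + R' := ⟨by omega, by omega⟩
    rw [if_pos h1, if_pos h2]
  · rw [if_neg h1]
    split_ifs
    · exact abs_nonneg _
    · exact le_rfl

/-! ## §2 The total-current autocorrelation as a double sum of pair correlations -/

section FixedN

variable {ω₂ lam β γ : ℝ} (hω : 0 < ω₂) (hl : 0 < lam) (hβ : 0 < β) (hγ : 0 < γ) (hN : 0 < N)
  {T : ℝ} (hT : 0 < T)
include hω hl hβ hγ hN hT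

/-- **Row sums**: `Σ_k ⟨j_i(0) j_k(t)⟩_{N,T} = ∫ j_i · (P_t J) dμ_{N,T}` (linearity in the kernel slot;
tree: `integral_mul_act_total_eq_sum`). [folklore] -/
theorem sum_pairCorr_eq_integral_mul_act_total (i : Fin N) (t : ℝ) :
    ∑ k : Fin N, ∫ z, (pinnedChain ω₂ lam β γ).bondCurrent N i z *
        (∫ y, (pinnedChain ω₂ lam β γ).bondCurrent N k y
          ∂((pinnedChain ω₂ lam β γ).transitionKernel N T T t.toNNReal z))
      ∂((pinnedChain ω₂ lam β γ).gibbsMeasure N T) =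
    ∫ z, (pinnedChain ω₂ lam β γ).bondCurrent N i z *
        (∫ y, (∑ k : Fin N, (pinnedChain ω₂ lam β γ).bondCurrent N k y)
          ∂((pinnedChain ω₂ lam β γ).transitionKernel N T T t.toNNReal z))
      ∂((pinnedChain ω₂ lam β γ).gibbsMeasure N T) :=
  (integral_mul_act_total_eq_sum hω hl hβ hγ hN hT (pinnedChain_continuous_bondCurrent ω₂ lam β γ N i)
    (pinnedChain_abs_bondCurrent_le_exp hω.le hl.le hβ.le γ N (quarter_inv_temp_admissible hT).1 i) t).symm

/-- **`c_N(t) = Σ_i Σ_k ⟨j_i(0) j_k(t)⟩_{N,T}`**: the total-current autocorrelation is the double sum of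
the pair correlations (linearity in both slots; every `j_i · P_t j_k` is `μ_{N,T}`-integrable).
[folklore] -/
theorem totalCurrentAutocorr_eq_sum_sum_pairCorr (t : ℝ) :
    ∫ z, (∑ i : Fin N, (pinnedChain ω₂ lam β γ).bondCurrent N i z) *
        (∫ y, (∑ i : Fin N, (pinnedChain ω₂ lam β γ).bondCurrent N i y)
          ∂((pinnedChain ω₂ lam β γ).transitionKernel N T T t.toNNReal z))
      ∂((pinnedChain ω₂ lam β γ).gibbsMeasure N T) =
    ∑ i : Fin N, ∑ k : Fin N, ∫ z, (pinnedChain ω₂ lam β γ).bondCurrent N i z *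
        (∫ y, (pinnedChain ω₂ lam β γ).bondCurrent N k y
          ∂((pinnedChain ω₂ lam β γ).transitionKernel N T T t.toNNReal z))
      ∂((pinnedChain ω₂ lam β γ).gibbsMeasure N T) := by
  obtain ⟨hϑ0, h2ϑ⟩ := quarter_inv_temp_admissible hT
  obtain ⟨MJ, -, hJb⟩ := abs_totalBondCurrent_le_exp hω.le hl.le hβ.le γ N hϑ0
  have hjc := pinnedChain_continuous_bondCurrent ω₂ lam β γ N
  have hjb := fun k : Fin N => pinnedChain_abs_bondCurrent_le_exp hω.le hl.le hβ.le γ N hϑ0 k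
  rw [integral_mul_act_total_eq_sum hω hl hβ hγ hN hT (continuous_totalBondCurrent ω₂ lam β γ N) hJb t]
  conv_rhs => rw [Finset.sum_comm]
  refine Finset.sum_congr rfl fun k _ => ?_
  simp_rw [Finset.sum_mul]
  exact integral_finsetSum _ fun i _ =>
    pinnedChain_integrable_mul_act hω hl.le hβ hγ hN hT hϑ0 h2ϑ (hjc i) (hjb i) (hjc k) (hjb k) _

/-! ## §3 The weighted pairing bound and the boundary rows -/

omit hl in
/-- **Weighted pairing bound**: for continuous observables `f, g` of exponential class and every
`λ > 0`, `|∫ f · P_u g dμ_T| ≤ ½(λ ∫ f² dμ_T + λ⁻¹ ∫ g² dμ_T)` (weighted AM–GM under the integral and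
the `L²(μ_T)`-contraction of the kernels). [folklore] -/
theorem pinnedChain_abs_integral_mul_act_le_weighted (hl : 0 ≤ lam) {ϑ Cf Cg : ℝ} (hϑ0 : 0 < ϑ)
    (h2ϑ : 2 * ϑ < 1 / T) {f g : PhaseSpace N → ℝ} (hf : Continuous f)
    (hfb : ∀ y, |f y| ≤ Cf * Real.exp (ϑ * (pinnedChain ω₂ lam β γ).hamiltonian N y))
    (hg : Continuous g)
    (hgb : ∀ y, |g y| ≤ Cg * Real.exp (ϑ * (pinnedChain ω₂ lam β γ).hamiltonian N y)) (u : ℝ≥0)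
    {lam' : ℝ} (hlam : 0 < lam') :
    |∫ z, f z * (∫ y, g y ∂((pinnedChain ω₂ lam β γ).transitionKernel N T T u z))
      ∂((pinnedChain ω₂ lam β γ).gibbsMeasure N T)| ≤
      (lam' * ∫ z, f z ^ 2 ∂((pinnedChain ω₂ lam β γ).gibbsMeasure N T) +
        lam'⁻¹ * ∫ z, g z ^ 2 ∂((pinnedChain ω₂ lam β γ).gibbsMeasure N T)) / 2 := by
  obtain ⟨hf2, -, -⟩ := pinnedChain_integral_sq_act_le hω hl hβ hγ hN hT hϑ0 h2ϑ hf hfb u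
  obtain ⟨-, hPg2, hle⟩ := pinnedChain_integral_sq_act_le hω hl hβ hγ hN hT hϑ0 h2ϑ hg hgb u
  have hprod := pinnedChain_integrable_mul_act hω hl hβ hγ hN hT hϑ0 h2ϑ hf hfb hg hgb u
  set P := pinnedChain ω₂ lam β γ with hP
  set μ := P.gibbsMeasure N T with hμ
  have key : ∀ a b : ℝ, |a * b| ≤ (lam' * a ^ 2 + lam'⁻¹ * b ^ 2) / 2 := by
    intro a b
    rw [abs_mul]
    have h1 : 2 * lam' * (|a| * |b|) ≤ lam' ^ 2 * |a| ^ 2 + |b| ^ 2 := by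
      nlinarith [sq_nonneg (lam' * |a| - |b|)]
    rw [sq_abs, sq_abs] at h1
    have h2 : (lam' * a ^ 2 + lam'⁻¹ * b ^ 2) / 2 = (lam' ^ 2 * a ^ 2 + b ^ 2) / (2 * lam') := by
      field_simp
    rw [h2, le_div_iff₀ (by positivity)]
    linarith
  have h1 : |∫ z, f z * (∫ y, g y ∂(P.transitionKernel N T T u z)) ∂μ|
      ≤ ∫ z, |f z * (∫ y, g y ∂(P.transitionKernel N T T u z))| ∂μ := abs_integral_le_integral_abs
  have h2 : ∫ z, |f z * (∫ y, g y ∂(P.transitionKernel N T T u z))| ∂μ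
      ≤ ∫ z, (lam' * f z ^ 2 + lam'⁻¹ * (∫ y, g y ∂(P.transitionKernel N T T u z)) ^ 2) / 2 ∂μ :=
    integral_mono hprod.abs (((hf2.const_mul lam').add (hPg2.const_mul lam'⁻¹)).div_const 2)
      fun z => key _ _
  have h3 : ∫ z, (lam' * f z ^ 2 + lam'⁻¹ * (∫ y, g y ∂(P.transitionKernel N T T u z)) ^ 2) / 2 ∂μ =
      (lam' * ∫ z, f z ^ 2 ∂μ + lam'⁻¹ * ∫ z, (∫ y, g y ∂(P.transitionKernel N T T u z)) ^ 2 ∂μ) / 2 := by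
    rw [integral_div, integral_add (hf2.const_mul _) (hPg2.const_mul _), integral_const_mul,
      integral_const_mul]
  have h4 : lam'⁻¹ * ∫ z, (∫ y, g y ∂(P.transitionKernel N T T u z)) ^ 2 ∂μ ≤ lam'⁻¹ * ∫ z, g z ^ 2 ∂μ :=
    mul_le_mul_of_nonneg_left hle (inv_nonneg.2 hlam.le)
  linarith

/-- **Every row is `o(N)`**: for every anchor `i`, every `t` and every `λ > 0`,
`|Σ_k ⟨j_i(0) j_k(t)⟩_{N,T}| ≤ ½(λM + λ⁻¹·3MN)` whenever `⟨j_k²⟩_{N,T} ≤ M` for all `k` (row sum =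
`∫ j_i · P_t J`, weighted pairing bound, `⟨J²⟩_{N,T} ≤ 3MN`). Used for the `≤ 2L` boundary rows of the
bond average. [folklore] -/
theorem abs_sum_pairCorr_le_weighted {M : ℝ}
    (hM : ∀ k : Fin N, ∫ z, (pinnedChain ω₂ lam β γ).bondCurrent N k z ^ 2
      ∂((pinnedChain ω₂ lam β γ).gibbsMeasure N T) ≤ M) (i : Fin N) (t : ℝ) {lam' : ℝ} (hlam : 0 < lam') :
    |∑ k : Fin N, ∫ z, (pinnedChain ω₂ lam β γ).bondCurrent N i z *
        (∫ y, (pinnedChain ω₂ lam β γ).bondCurrent N k y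
          ∂((pinnedChain ω₂ lam β γ).transitionKernel N T T t.toNNReal z))
      ∂((pinnedChain ω₂ lam β γ).gibbsMeasure N T)| ≤ (lam' * M + lam'⁻¹ * (3 * M * N)) / 2 := by
  obtain ⟨hϑ0, h2ϑ⟩ := quarter_inv_temp_admissible hT
  obtain ⟨MJ, -, hJb⟩ := abs_totalBondCurrent_le_exp hω.le hl.le hβ.le γ N hϑ0
  rw [sum_pairCorr_eq_integral_mul_act_total hω hl hβ hγ hN hT i t]
  have h := pinnedChain_abs_integral_mul_act_le_weighted hω hβ hγ hN hT hl.le hϑ0 h2ϑ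
    (pinnedChain_continuous_bondCurrent ω₂ lam β γ N i)
    (pinnedChain_abs_bondCurrent_le_exp hω.le hl.le hβ.le γ N hϑ0 i)
    (continuous_totalBondCurrent ω₂ lam β γ N) hJb t.toNNReal hlam
  have h1 : lam' * ∫ z, (pinnedChain ω₂ lam β γ).bondCurrent N i z ^ 2
      ∂((pinnedChain ω₂ lam β γ).gibbsMeasure N T) ≤ lam' * M :=
    mul_le_mul_of_nonneg_left (hM i) hlam.le
  have h2 : lam'⁻¹ * ∫ z, (∑ k : Fin N, (pinnedChain ω₂ lam β γ).bondCurrent N k z) ^ 2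
      ∂((pinnedChain ω₂ lam β γ).gibbsMeasure N T) ≤ lam'⁻¹ * (3 * M * N) :=
    mul_le_mul_of_nonneg_left (pinnedChain_integral_sq_totalCurrent_le hω hl.le hβ hγ hN hT hM)
      (inv_nonneg.2 hlam.le)
  linarith

end FixedN

/-- **Registered helper stub `stub_totalCurrentAutocorrEqSumPairCorr`** (part 3 of the reduction of the
registered stub S3 `stub_fixedFrequencyMatching`, line series-law-at-every-laplace-frequency): for
`P = pinnedChain ω₂ lam β γ` (all `> 0`), `T > 0`, `N ≥ 1` and every `t`, the open chain's total-current
autocorrelation is the double sum of the equilibrium pair correlations of bond currents,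
`c_N(t) = ∫ J · (P_t J) dμ_{N,T} = Σ_i Σ_k ∫ j_i · (P_t j_k) dμ_{N,T}`. [folklore] -/
theorem stub_totalCurrentAutocorrEqSumPairCorr :
    ∀ ω₂ lam β γ : ℝ, 0 < ω₂ → 0 < lam → 0 < β → 0 < γ → ∀ T : ℝ, 0 < T → ∀ N : ℕ, 0 < N → ∀ t : ℝ,
      (∫ z, (∑ i : Fin N, (Literature.MathematicalPhysics.KineticTheory.HeatConduction.pinnedChain
              ω₂ lam β γ).bondCurrent N i z) *
          (∫ y, (∑ i : Fin N, (Literature.MathematicalPhysics.KineticTheory.HeatConduction.pinnedChain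
              ω₂ lam β γ).bondCurrent N i y)
            ∂((Literature.MathematicalPhysics.KineticTheory.HeatConduction.pinnedChain
              ω₂ lam β γ).transitionKernel N T T t.toNNReal z))
        ∂((Literature.MathematicalPhysics.KineticTheory.HeatConduction.pinnedChain
              ω₂ lam β γ).gibbsMeasure N T)) =
      ∑ i : Fin N, ∑ k : Fin N,
        ∫ z, (Literature.MathematicalPhysics.KineticTheory.HeatConduction.pinnedChain
                ω₂ lam β γ).bondCurrent N i z *
          (∫ y, (Literature.MathematicalPhysics.KineticTheory.HeatConduction.pinnedChain
                ω₂ lam β γ).bondCurrent N k y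
            ∂((Literature.MathematicalPhysics.KineticTheory.HeatConduction.pinnedChain
                ω₂ lam β γ).transitionKernel N T T t.toNNReal z))
          ∂((Literature.MathematicalPhysics.KineticTheory.HeatConduction.pinnedChain
                ω₂ lam β γ).gibbsMeasure N T) := by
  intro ω₂ lam β γ hω hl hβ hγ T hT N hN t
  exact totalCurrentAutocorr_eq_sum_sum_pairCorr hω hl hβ hγ hN hT t

end Summit.AtomisticToContinuum.FouriersLaw.Theorems.AbelThermodynamicLimit.SeriesLawAtEveryLaplaceFrequency

end
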